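import Summits.BirchSwinnertonDyer.BirchSwinnertonDyer.Theorems.SylvesterTwoHeegnerIndexCoupledTelescopeSelmerAway
import Summits.BirchSwinnertonDyer.BirchSwinnertonDyer.Theorems.SylvesterTwoHeegnerIndexCMHalfDecompositionAtThree
import Literature.NumberTheory.EllipticCurves.KolyvaginClassLocalConditionCoprimeIndex
import HarnessLib

/-!
# The COUPLED Cassels–Tate telescope, RESIDUE 7′ (VARIANT Q): the (T-L1) «Selmer away from `λ` and the places over
# `m`» clause FOR `B = E_p` AT `p ≡ 7 (mod 9)` — the additive place `w ∣ 3` by the COPRIME-INDEX criterion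
# (crux `UpperOffV0HSYPlus`, stmt-BirchSwinnertonDyer-19804)

Skeleton VARIANT Q `Cruxes/UpperOffV0HSYPlus/Lines/coupled_variantQ.lean` d342db51dc602551, stub `stub_residueSevenHalved`
(RESIDUE 7′, rows `p ≡ 7 (9)`; planner D762 (3) item «(T8) `selmerAway_of_recipe_prime` at p ≡ 7»).  (T8)
`SylvesterTwoCoupledTelescope.selmerAway_of_recipe_prime` (`…CoupledTelescopeSelmerAway`, p ≡ 4 (9)) discharges the
display's l.100–111 for a recipe-shaped class on `B_K = E_p ⊗ K` at every place `v ∤ λ·m`; its ONLY p-class input is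
the place `w ∣ 3`, where at `p ≡ 4 (9)` the local condition is EMPTY (`H¹(K_w, B[2^k]) = 0`,
`mem_localKers_cubeSumCurve_prime_of_three_mem`).  At `p ≡ 7 (9)` `B(K_w)[2] = B[2]`, `H¹(K_w, B[2^k]) ≠ 0`
(memo two §67.2 (W2-d); memo g44 §2–§3), and the Selmer condition of the HALVED class `c′_B(n₀)` at `w` is instead
the tower fixing read locally: the decomposition group of `K[9pn₀]/K` at `w` has order `2·odd` (#S10a
`exists_decompositionBound_three`), its involution `φ` FIXES the CM point `y_{n₀}` ((W2-b), displayed), so the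
preimage `Φ ≤ Γ_{K_w}` of `⟨φ⟩` is OPEN of ODD index and fixes `v_B` and the derived point `P = κ⁻¹ιe(D_l y)` — and
k-ty1's criterion `JZero.kolyvaginClass_cubicTwist_chiComponent_mem_selmerLocalKer_of_isCoprime` (cor∘res = index,
prime to `2^k`) puts the class of the χ-sum `ψ_B(Σᵢ ρ_{tᵢ}(tᵢ • P))` in the Selmer local condition at `w`, for ANY
index family `t` (so for the HALF transversal).  The level-`ℓℓ′`, modulus-`2` instance is CMHalf #S9a
`half_pairClass_mem_selmerLocalKer_three` (p685405-era); this file is its any-conductor / any-`2^k` / recipe-shape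
form plus (T8)'s other places verbatim.
* `selmerThree_of_recipe_prime_halved` — the place `w ∣ 3` alone, from the LOCAL datum `Φ` (open, index prime to
  `nl`, acting on `emb K[9pn₀]` through `{1, φ}`) and a lift `φ̃ ∈ Γ_K` of `φ` fixing `P`.
* ★ `selmerAway_of_recipe_prime_halved` — RESIDUE 7′ l.106–111 shape: every place `v` not over a prime factor of
  `n₀`, for the class of `ψ_B(Σᵢ ρ_{tᵢ}(tᵢ • P))`, `P ∈ E₉(K̄)^N` with `φ̃ • P = P`, GIVEN the involution `φ ≠ 1`
  of `K[9pn₀]/K` realised by some `τ₀ ∈ Γ_{K_w}` at the place `w ∋ 3` (the outputs of #S10c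
  `SylvesterTwoCMHalf.decompFixing_of_involutionFixing` at level `n₀`; `Φ` is then #S10a §3
  `exists_oddIndex_localFixer`).
Theorems only (no definition / named fact / instance / notation); CONDITIONAL on the displayed tower-fixing binders
(cell lemma (W2-b), registered stub `stub_levelFixingSeven`); nothing asserted on 19804; no stub closed on the ledger;
X12.CMAtTwo NOT proved; BSD not claimed for any curve.  Sources: McCallum 1991 Lemma 4.3; Gross 1991 Prop. 6.2 (1),
§12; Serre, Galois Cohomology I §2.4 Prop. 9; HSY 2019 §§1–2, Prop. 2.4; Neukirch ANT II §9.
`lean search 'selmerAway_of_recipe_prime_halved|selmerThree_of_recipe'` → nothing before this file.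
-/

-- every Summits module is named `Summit.<Summit>.<Problem>…`: the duplicated component is by design
set_option linter.dupNamespace false
set_option autoImplicit false

noncomputable section

open scoped Classical
open WeierstrassCurve NumberField IsDedekindDomain Field
open Literature.NumberTheory.EllipticCurves Literature.NumberTheory.GaloisRepresentations
  Literature.NumberTheory.EllipticCurves.HuShuYin2019 Literature.NumberTheory.EllipticCurves.KolyvaginCocycle
  Literature.NumberTheory.EllipticCurves.RingClassField

namespace Summit.BirchSwinnertonDyer.BirchSwinnertonDyer.Theorems.SylvesterTwoCoupledTelescope

open Summit.BirchSwinnertonDyer.BirchSwinnertonDyer.Theorems.SylvesterTwoCMData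
  Summit.BirchSwinnertonDyer.BirchSwinnertonDyer.Theorems.SylvesterTwoCMHalf
  Summit.BirchSwinnertonDyer.Rank1Residual.X11b Summit.BirchSwinnertonDyer.Rank1Residual.X11b.RingClassTower

variable {K : Type} [Field K] [NumberField K]

set_option maxHeartbeats 800000 in
/-- **The χ-sum class on `B_K = E_p ⊗ K` is Selmer at `w ∣ 3` from the LOCAL tower fixing** (any conductor `m`, any
level `nl`): if an open subgroup `Φ ≤ Γ_{K_w}` of index prime to `nl` acts on the embedded `K[m]` through `{1, φ}`,
`φ` fixes cube roots `c₃, c_p ∈ K[m]` of `3, p`, and a lift `φ̃ ∈ Γ_K` of `φ` fixes `P ∈ E₉(K̄)^N`, then `Φ` fixes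
`v_B` (a cube root of `p/9 = (c_p/c₃²)³`, `μ₃ ⊂ K`) and `P` (`N` and `φ̃` do), and k-ty1's coprime-index criterion applies.
[cite: GrossLMS1991, Prop. 6.2 (1), §12] [cite: McCallumLMS1991, Lemma 4.3] [cite: SerreGaloisCohomology1997, I §2.4 Prop. 9]
[cite: HuShuYin2019, §2 Prop. 2.4] -/
theorem selmerThree_of_recipe_prime_halved {ω : K} (hω : ω ^ 2 + ω + 1 = 0) (h2 : Module.finrank ℚ K = 2)
    {p : ℕ} (hp0 : p ≠ 0) (ιK : K →+* ℂ) {m : ℕ} (hm0 : m ≠ 0) (emb : ringClassField K ιK m →+* AlgebraicClosure K)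
    (hemb : ∀ x : K, emb (algebraMap K (ringClassField K ιK m) x) = algebraMap K (AlgebraicClosure K) x)
    (N : Subgroup (Field.absoluteGaloisGroup K))
    (hN : ∀ g, g ∈ N ↔ ∀ x : ringClassField K ιK m,
      (show AlgebraicClosure K ≃ₐ[K] AlgebraicClosure K from g) (emb x) = emb x)
    {vB : AlgebraicClosure K} (hvBc : vB ^ 3 = algebraMap ℚ (AlgebraicClosure K) ((p : ℚ) / 9)) (hvB : vB ≠ 0)
    (hvB3 : ∀ g : Field.absoluteGaloisGroup K, ((show AlgebraicClosure K ≃ₐ[K] AlgebraicClosure K from g) vB) ^ 3 = vB ^ 3)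
    {ψ : geomPoints ((cubeSumCurve 9).baseChange K) ≃+ geomPoints ((cubeSumCurve (p : ℚ)).baseChange K)}
    (hψ : ∀ {x y : AlgebraicClosure K}
      (h : (((cubeSumCurve 9).baseChange K).baseChange (AlgebraicClosure K)).toAffine.Nonsingular x y),
      ∃ h', ψ (Affine.Point.some x y h) = Affine.Point.some (vB ^ 2 * x) (vB ^ 3 * y) h')
    {ρ : Field.absoluteGaloisGroup K →
      geomPoints ((cubeSumCurve 9).baseChange K) ≃+ geomPoints ((cubeSumCurve 9).baseChange K)}
    (hρ : ∀ (g : Field.absoluteGaloisGroup K) {x y : AlgebraicClosure K}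
        (h : (((cubeSumCurve 9).baseChange K).baseChange (AlgebraicClosure K)).toAffine.Nonsingular x y),
        ∃ h', ρ g (Affine.Point.some x y h) =
          Affine.Point.some (((show AlgebraicClosure K ≃ₐ[K] AlgebraicClosure K from g) vB / vB) ^ 2 * x) y h')
    {ιt : Type} [Fintype ιt] (t : ιt → Field.absoluteGaloisGroup K)
    {A : AddSubgroup (geomPoints ((cubeSumCurve (p : ℚ)).baseChange K))} {nl : ℕ}
    {hdiv : ∀ X : geomPoints ((cubeSumCurve (p : ℚ)).baseChange K),
      ∃ R : geomPoints ((cubeSumCurve (p : ℚ)).baseChange K), ((nl : ℕ) : ℤ) • R = X}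
    (hA : IsAdmissible (Field.absoluteGaloisGroup K) A ((nl : ℕ) : ℤ))
    {P : geomPoints ((cubeSumCurve 9).baseChange K)}
    (hPN : P ∈ FixedPoints.addSubgroup N (geomPoints ((cubeSumCurve 9).baseChange K)))
    (hQ' : ψ (∑ i, ρ (t i) (t i • P)) ∈ invPoints (Field.absoluteGaloisGroup K) A ((nl : ℕ) : ℤ))
    -- THE TOWER FIXING at this level, GLOBAL part: `φ ∈ Aut_K K[m]` fixing cube roots of `3, p`, a lift `φ̃` fixing `P`
    {c₃ cp : ringClassField K ιK m} (hc₃ : c₃ ^ 3 = 3) (hcp : cp ^ 3 = (p : ringClassField K ιK m))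
    (φ : ringClassField K ιK m ≃ₐ[K] ringClassField K ιK m) (hφ3 : φ c₃ = c₃) (hφp : φ cp = cp)
    {φt : Field.absoluteGaloisGroup K}
    (hφt : ∀ x : ringClassField K ιK m, (show AlgebraicClosure K ≃ₐ[K] AlgebraicClosure K from φt) (emb x) = emb (φ x))
    (hφP : φt • P = P)
    -- LOCAL part at `w`: `Φ` open, index prime to `nl`, acting through `{1, φ}`
    (v : HeightOneSpectrum (𝓞 K)) (Φ : Subgroup (Field.absoluteGaloisGroup (v.adicCompletion K)))
    (hΦ : IsOpen (Φ : Set (Field.absoluteGaloisGroup (v.adicCompletion K))))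
    (hcop : IsCoprime (Φ.index : ℤ) ((nl : ℕ) : ℤ))
    (hΦdich : ∀ τ ∈ Φ,
      (∀ x : ringClassField K ιK m, (show AlgebraicClosure K ≃ₐ[K] AlgebraicClosure K from
        resGal (K := K) (v.adicCompletion K) τ) (emb x) = emb x) ∨
      (∀ x : ringClassField K ιK m, (show AlgebraicClosure K ≃ₐ[K] AlgebraicClosure K from
        resGal (K := K) (v.adicCompletion K) τ) (emb x) = emb (φ x))) :
    kolyvaginClass ((cubeSumCurve (p : ℚ)).baseChange K) ((nl : ℕ) : ℤ) hdiv hA (ψ (∑ i, ρ (t i) (t i • P))) hQ' ∈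
      selmerLocalKer ((cubeSumCurve (p : ℚ)).baseChange K) (v.adicCompletion K) ((nl : ℕ) : ℤ) := by
  have hK := JZero.isImaginaryQuadratic_of_sq_add_self_add_one hω h2
  haveI := (finiteDimensional_and_isGalois_ringClassField hK ιK hm0).2
  have hcomm := commutator_mem_of_ringClassField hK ιK hm0 emb hemb N hN
  have hPN' : ∀ h ∈ N, h • P = P := (JZero.mem_fixedPoints_iff _ N _).mp hPN
  -- `Φ` fixes `emb c₃`, `emb cp` (both `1` and `φ` do), hence the cube root `w = emb cp / emb c₃²` of `p/9`, hence `v_B`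
  have hc₃0 : c₃ ≠ 0 := fun h ↦ by rw [h] at hc₃; norm_num at hc₃
  have hcp0 : cp ≠ 0 := fun h ↦ by
    rw [h, zero_pow three_ne_zero] at hcp; exact hp0 (by exact_mod_cast hcp.symm)
  have hw3 : (emb cp / emb c₃ ^ 2) ^ 3 = vB ^ 3 := by
    rw [hvBc, div_pow, ← pow_mul, ← map_pow, ← map_pow, hcp, show 2 * 3 = 3 * 2 from rfl, pow_mul, hc₃,
      map_natCast, map_pow, map_ofNat, eq_ratCast]
    push_cast; ring
  have hw0 : emb cp / emb c₃ ^ 2 ≠ 0 :=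
    div_ne_zero ((map_ne_zero emb).mpr hcp0) (pow_ne_zero 2 ((map_ne_zero emb).mpr hc₃0))
  have hΦfix : ∀ τ ∈ Φ, ∀ x : ringClassField K ιK m, φ x = x →
      (show AlgebraicClosure K ≃ₐ[K] AlgebraicClosure K from resGal (K := K) (v.adicCompletion K) τ) (emb x) =
        emb x := by
    intro τ hτ x hx
    rcases hΦdich τ hτ with h1 | hφ'
    · exact h1 x
    · rw [hφ', hx]
  have hΦv : ∀ τ ∈ Φ, (show AlgebraicClosure K ≃ₐ[K] AlgebraicClosure K from
      resGal (K := K) (v.adicCompletion K) τ) vB = vB := fun τ hτ ↦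
    JZero.apply_eq_self_of_cubeRoot hω _ hw0 hw3.symm
      (by rw [map_div₀, map_pow, hΦfix τ hτ c₃ hφ3, hΦfix τ hτ cp hφp])
  -- `Φ` fixes `P` (`1`: `P ∈ E₉(K̄)^N`; `φ`: `res τ = (res τ · φ̃⁻¹) · φ̃` with `res τ · φ̃⁻¹ ∈ N`)
  have hΦP : ∀ τ ∈ Φ, resGal (K := K) (v.adicCompletion K) τ • P = P := by
    intro τ hτ
    rcases hΦdich τ hτ with h1 | hφ'
    · exact hPN' _ ((hN _).mpr h1)
    · have hmem : resGal (K := K) (v.adicCompletion K) τ * φt⁻¹ ∈ N := by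
        refine (hN _).mpr fun x ↦ ?_
        have e2 : (show AlgebraicClosure K ≃ₐ[K] AlgebraicClosure K from φt⁻¹) (emb x) = emb (φ.symm x) := by
          have e3 := hφt (φ.symm x)
          rw [φ.apply_symm_apply] at e3
          rw [← e3]
          exact (show AlgebraicClosure K ≃ₐ[K] AlgebraicClosure K from φt).symm_apply_apply _
        change (show AlgebraicClosure K ≃ₐ[K] AlgebraicClosure K from resGal (K := K) (v.adicCompletion K) τ)
          ((show AlgebraicClosure K ≃ₐ[K] AlgebraicClosure K from φt⁻¹) (emb x)) = emb x
        rw [e2, hφ', φ.apply_symm_apply]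
      have hφP' : φt⁻¹ • P = P := by rw [inv_smul_eq_iff, hφP]
      calc resGal (K := K) (v.adicCompletion K) τ • P
          = (resGal (K := K) (v.adicCompletion K) τ * φt⁻¹ * φt) • P := by rw [inv_mul_cancel_right]
        _ = (resGal (K := K) (v.adicCompletion K) τ * φt⁻¹) • (φt • P) := by rw [mul_smul]
        _ = P := by rw [hφP, hPN' _ hmem]
  exact JZero.kolyvaginClass_cubicTwist_chiComponent_mem_selmerLocalKer_of_isCoprime hω hvB hvB3 hρ hψ N hcomm t
    hA hPN' hQ' Φ hΦ hcop hΦv hΦP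

set_option maxHeartbeats 800000 in
/-- ★ **(T-L1) Selmer-away for the HALVED recipe-shaped class on `B_K = E_p ⊗ K`, conductor `9·p·n₀`, level `2^k`,
`p ≡ 1 (mod 3)` (so `p ≡ 4` OR `7 (mod 9)`)** — RESIDUE 7′ l.106–111 shape.  The class is that of the χ-sum
`ψ_B(Σᵢ ρ_{tᵢ}(tᵢ • P))`, `P ∈ E₉(K̄)^N` (ANY index family `t`, e.g. the half transversal).  INPUT displayed as
binders: the tower fixing at level `n₀` in #S10c's currency — an involution `φ ≠ 1` of `K[9pn₀]/K` fixing cube roots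
`c₃, c_p ∈ K[9pn₀]`, realised at the place `w ∋ 3` by some `τ₀ ∈ Γ_{K_w}`, and a lift `φ̃ ∈ Γ_K` fixing `P`
(`φ · y = y` transported by `smul_symm_embPoints_eq_of_apply_eq`).  At `w ∣ 3`: #S10a §3 `exists_oddIndex_localFixer`
+ `selmerThree_of_recipe_prime_halved`; elsewhere (T8) verbatim (`v ∣ p` additive with empty condition, good places
by Gross 6.2 (1), infinite places).
[cite: McCallumLMS1991, §4 Lemma 4.3] [cite: GrossLMS1991, Prop. 6.2 (1)] [cite: HuShuYin2019, §1 p. 4, §2 p. 8, Prop. 2.4]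
[cite: NeukirchANT1999, Ch. II §9 Prop. (9.6)] -/
theorem selmerAway_of_recipe_prime_halved {ω : K} (hω : ω ^ 2 + ω + 1 = 0) (h2 : Module.finrank ℚ K = 2)
    {p : ℕ} (hp : p.Prime) (hp3 : p % 3 = 1) (nl : ℕ) {k : ℕ} (hn : nl = 2 ^ k) {n₀ : ℕ} (hn₀ : n₀ ≠ 0)
    (hn₀3 : ¬ 3 ∣ n₀)
    (ιK : K →+* ℂ) (emb : ringClassField K ιK (9 * p * n₀) →+* AlgebraicClosure K)
    (hemb : ∀ x : K, emb (algebraMap K (ringClassField K ιK (9 * p * n₀)) x) = algebraMap K (AlgebraicClosure K) x)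
    (N : Subgroup (Field.absoluteGaloisGroup K))
    (hN : ∀ g, g ∈ N ↔ ∀ x : ringClassField K ιK (9 * p * n₀),
      (show AlgebraicClosure K ≃ₐ[K] AlgebraicClosure K from g) (emb x) = emb x)
    {vB : AlgebraicClosure K} (hvBc : vB ^ 3 = algebraMap ℚ (AlgebraicClosure K) ((p : ℚ) / 9)) (hvB : vB ≠ 0)
    (hvB3 : ∀ g : Field.absoluteGaloisGroup K, ((show AlgebraicClosure K ≃ₐ[K] AlgebraicClosure K from g) vB) ^ 3 = vB ^ 3)
    {ψ : geomPoints ((cubeSumCurve 9).baseChange K) ≃+ geomPoints ((cubeSumCurve (p : ℚ)).baseChange K)}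
    (hψ : ∀ {x y : AlgebraicClosure K}
      (h : (((cubeSumCurve 9).baseChange K).baseChange (AlgebraicClosure K)).toAffine.Nonsingular x y),
      ∃ h', ψ (Affine.Point.some x y h) = Affine.Point.some (vB ^ 2 * x) (vB ^ 3 * y) h')
    {ρ : Field.absoluteGaloisGroup K →
      geomPoints ((cubeSumCurve 9).baseChange K) ≃+ geomPoints ((cubeSumCurve 9).baseChange K)}
    (hρ : ∀ (g : Field.absoluteGaloisGroup K) {x y : AlgebraicClosure K}
        (h : (((cubeSumCurve 9).baseChange K).baseChange (AlgebraicClosure K)).toAffine.Nonsingular x y),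
        ∃ h', ρ g (Affine.Point.some x y h) =
          Affine.Point.some (((show AlgebraicClosure K ≃ₐ[K] AlgebraicClosure K from g) vB / vB) ^ 2 * x) y h')
    (hNv : ∀ h ∈ N, (show AlgebraicClosure K ≃ₐ[K] AlgebraicClosure K from h) vB = vB)
    {ιt : Type} [Fintype ιt] (t : ιt → Field.absoluteGaloisGroup K)
    {A : AddSubgroup (geomPoints ((cubeSumCurve (p : ℚ)).baseChange K))}
    {hdiv : ∀ X : geomPoints ((cubeSumCurve (p : ℚ)).baseChange K),
      ∃ R : geomPoints ((cubeSumCurve (p : ℚ)).baseChange K), ((nl : ℕ) : ℤ) • R = X}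
    (hA : IsAdmissible (Field.absoluteGaloisGroup K) A ((nl : ℕ) : ℤ))
    {P : geomPoints ((cubeSumCurve 9).baseChange K)}
    (hPN : P ∈ FixedPoints.addSubgroup N (geomPoints ((cubeSumCurve 9).baseChange K)))
    (hQN : (∑ i, ρ (t i) (t i • P)) ∈ FixedPoints.addSubgroup N (geomPoints ((cubeSumCurve 9).baseChange K)))
    (hQ' : ψ (∑ i, ρ (t i) (t i • P)) ∈ invPoints (Field.absoluteGaloisGroup K) A ((nl : ℕ) : ℤ))
    -- THE TOWER FIXING at the level `n₀` (#S10c currency; (W2-b) displayed, not proved)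
    {c₃ cp : ringClassField K ιK (9 * p * n₀)} (hc₃ : c₃ ^ 3 = 3) (hcp : cp ^ 3 = (p : ringClassField K ιK (9 * p * n₀)))
    (φ : ringClassField K ιK (9 * p * n₀) ≃ₐ[K] ringClassField K ιK (9 * p * n₀)) (hφ1 : φ ≠ 1) (hφ2 : φ * φ = 1)
    (hφ3 : φ c₃ = c₃) (hφp : φ cp = cp)
    (hτ : ∀ w : HeightOneSpectrum (𝓞 K), ((3 : ℕ) : 𝓞 K) ∈ w.asIdeal →
      ∃ τ₀ : Field.absoluteGaloisGroup (w.adicCompletion K), ∀ x : ringClassField K ιK (9 * p * n₀),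
        (show AlgebraicClosure K ≃ₐ[K] AlgebraicClosure K from resGal (K := K) (w.adicCompletion K) τ₀) (emb x) =
          emb (φ x))
    {φt : Field.absoluteGaloisGroup K}
    (hφt : ∀ x : ringClassField K ιK (9 * p * n₀),
      (show AlgebraicClosure K ≃ₐ[K] AlgebraicClosure K from φt) (emb x) = emb (φ x))
    (hφP : φt • P = P) :
    ∀ v : Place K, (∀ q : HeightOneSpectrum (𝓞 K), (∃ r ∈ n₀.primeFactors, (r : 𝓞 K) ∈ q.asIdeal) → v ≠ Sum.inr q) →
      kolyvaginClass ((cubeSumCurve (p : ℚ)).baseChange K) ((nl : ℕ) : ℤ) hdiv hA (ψ (∑ i, ρ (t i) (t i • P))) hQ' ∈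
        selmerLocalKer ((cubeSumCurve (p : ℚ)).baseChange K) (Place.Completion v) ((nl : ℕ) : ℤ) := by
  have hK : IsImaginaryQuadratic K := JZero.isImaginaryQuadratic_of_sq_add_self_add_one hω h2
  have hp0 : p ≠ 0 := hp.ne_zero
  have hp2 : p ≠ 2 := by rintro rfl; norm_num at hp3
  have hp3' : p ≠ 3 := by rintro rfl; norm_num at hp3
  have hm0 : 9 * p * n₀ ≠ 0 := mul_ne_zero (mul_ne_zero (by norm_num) hp0) hn₀
  rintro (x | v) hv
  · exact mem_selmerLocalKer_infinitePlace_of_isImaginaryQuadratic hK _ x _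
  · by_cases hpv : ((p : ℕ) : 𝓞 K) ∈ v.asIdeal
    · subst hn; exact (mem_localKers_cubeSumCurve_prime_of_mem hω h2 hp hp2 hp3' v hpv k _).1
    by_cases h3v : ((3 : ℕ) : 𝓞 K) ∈ v.asIdeal
    · -- THE PLACE OVER `3`: the odd-index local fixer and the coprime-index criterion
      obtain ⟨τ₀, hτ₀⟩ := hτ v h3v
      obtain ⟨Φ, hΦ, hcop, hΦdich⟩ :=
        exists_oddIndex_localFixer hω h2 ιK hp hp3 hn₀ hn₀3 v h3v emb hemb hφ1 hφ2 hτ₀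
      have hcop' : IsCoprime (Φ.index : ℤ) ((nl : ℕ) : ℤ) := by
        subst hn; push_cast; exact hcop.pow_right
      exact selmerThree_of_recipe_prime_halved hω h2 hp0 ιK hm0 emb hemb N hN hvBc hvB hvB3 hψ hρ t hA hPN hQ'
        hc₃ hcp φ hφ3 hφp hφt hφP v Φ hΦ hcop' hΦdich
    have hn₀v : ((n₀ : ℕ) : 𝓞 K) ∉ v.asIdeal :=
      natCast_not_mem_of_primeFactors hn₀ v fun r hr h ↦ hv v ⟨r, hr, h⟩ rfl
    have h9 : ((9 * p * n₀ : ℕ) : 𝓞 K) ∉ v.asIdeal := by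
      intro h
      push_cast at h
      rcases v.isPrime.mem_or_mem h with h' | h'
      · rcases v.isPrime.mem_or_mem h' with h'' | h''
        · exact h3v (by
            have := v.isPrime.mem_of_pow_mem 2 (by simpa [show ((9 : 𝓞 K)) = (3 : 𝓞 K) ^ 2 by norm_num] using h'')
            exact_mod_cast this)
        · exact hpv (by exact_mod_cast h'')
      · exact hn₀v (by exact_mod_cast h')
    exact kolyvaginClass_cmFrame_cubeSumCurve_prime_mem_selmerLocalKer hK ιK hm0 emb hemb N hN hp
      hp2 hψ hNv hA hQN hQ' v h3v hpv h9

end Summit.BirchSwinnertonDyer.BirchSwinnertonDyer.Theorems.SylvesterTwoCoupledTelescope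

end
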